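import Mathlib
import Literature.NumberTheory.Transcendental.KZCalculusProofs

/-!
# Stub `stub_floorCandidatesFinite` — crux `OffTetraSectorKernel`, line `odd-hyperbolic-ladder` (rung 2)

Rung 2 of the hyperbolic scissors ladder: a finite-volume `ℚ̄`-geodesic polytope of `ℍ³` in normal
form is cut out by constraints `0 < L i • Ql p` with the paraboloid lift `Ql p = (|p|², p₀, p₁, 1)`.
On the floor `t = 0` the constraint `i` has the TRACE
`gᵢ(n) = L i 0 · |n|² + L i 1 · n₀ + L i 2 · n₁ + L i 3`, a generalized circle (a circle if
`L i 0 ≠ 0`, a line if `L i 0 = 0`).  The FLOOR CANDIDATES are the points of the boundary plane where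
the traces of two DIFFERENT constraints vanish.  We prove that, for pairwise non-proportional
coefficient rows with non-zero trace parts and real-algebraic entries, the floor candidates form a
finite set of points with real-algebraic coordinates.

Proof.  For a pair of rows `A, B` the affine combination `B 0 • g_A − A 0 • g_B = a n₀ + b n₁ + d`
vanishes on the common zero set `Z`.
* If `(a, b) ≠ 0` this is a genuine line and one of `g_A, g_B` is a genuine circle (`A 0 ≠ 0` or
  `B 0 ≠ 0`); eliminating either coordinate between the line and the circle shows that each
  coordinate of a point of `Z` is a root of a quadratic with leading coefficient `α (a² + b²) ≠ 0`
  and algebraic coefficients: finitely many values (`Polynomial.finite_setOf_isRoot`), all algebraic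
  (`(2 α s + β)² = β² − 4 α γ` and `IsAlgebraic.of_pow`).
* If `(a, b) = 0` and `d ≠ 0` then `Z = ∅`.
* If `(a, b, d) = 0` then `B 0 • A = A 0 • B`; if `A 0 ≠ 0` or `B 0 ≠ 0` the rows are proportional
  (excluded); if `A 0 = B 0 = 0` both traces are lines: transversal lines meet in one point (Cramer,
  algebraic), parallel lines with a common point have proportional rows (excluded).
The candidate set is the finite union over pairs.

References: M. Kontsevich, D. Zagier, *Periods* (2001), §1.2 (the scissors-congruence moves);
elementary analytic geometry (radical axis of two circles).
-/

noncomputable section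

open Set MeasureTheory
open Literature.NumberTheory.Transcendental

namespace Summit.KontsevichZagierPeriods.HyperbolicBloch.OffTetraSectorKernel

/-- A real root `s` of `α s² + β s + γ` with `(α, β) ≠ 0` and real-algebraic coefficients is
algebraic: for `α ≠ 0`, `(2 α s + β)² = β² − 4 α γ` is algebraic, hence so is `2 α s + β`.
[folklore] -/
theorem cand_root_isAlgebraic {α β γ s : ℝ} (h0 : α ≠ 0 ∨ β ≠ 0) (hα : IsAlgebraic ℚ α)
    (hβ : IsAlgebraic ℚ β) (hγ : IsAlgebraic ℚ γ) (hs : α * s ^ 2 + β * s + γ = 0) :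
    IsAlgebraic ℚ s := by
  rcases eq_or_ne α 0 with hα0 | hα0
  · have hβ0 : β ≠ 0 := h0.resolve_left (not_not.2 hα0)
    have h : s = -γ * β⁻¹ := by
      rw [eq_mul_inv_iff_mul_eq₀ hβ0]
      rw [hα0] at hs
      linear_combination hs
    rw [h]
    exact hγ.neg.mul hβ.inv
  · have hsq : (2 * α * s + β) ^ 2 = β ^ 2 - 4 * α * γ := by linear_combination (4 * α) * hs
    have h2 : IsAlgebraic ℚ (2 * α * s + β) := by
      refine IsAlgebraic.of_pow two_pos (hsq ▸ ?_)
      apply_rules [IsAlgebraic.sub, IsAlgebraic.add, IsAlgebraic.neg, IsAlgebraic.mul, IsAlgebraic.pow,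
        isAlgebraic_nat]
    have h : s = (2 * α * s + β - β) * (2 * α)⁻¹ := by
      rw [eq_mul_inv_iff_mul_eq₀ (mul_ne_zero two_ne_zero hα0)]
      ring
    rw [h]
    exact (h2.sub hβ).mul ((isAlgebraic_nat 2).mul hα).inv

open Polynomial in
/-- The real zero set of `α s² + β s + γ` with `(α, β) ≠ 0` is finite (a non-zero polynomial).
[folklore] -/
theorem cand_roots_finite {α β γ : ℝ} (h0 : α ≠ 0 ∨ β ≠ 0) :
    {s : ℝ | α * s ^ 2 + β * s + γ = 0}.Finite := by
  have hp : (C α * X ^ 2 + C β * X + C γ : ℝ[X]) ≠ 0 := by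
    intro hp
    have h1 := congrArg (fun p : ℝ[X] => p.coeff 1) hp
    have h2 := congrArg (fun p : ℝ[X] => p.coeff 2) hp
    simp [coeff_C] at h1 h2
    exact h0.elim (fun h => h h2) (fun h => h h1)
  refine (finite_setOf_isRoot hp).subset fun s hs => ?_
  simp only [Set.mem_setOf_eq, IsRoot.def, eval_add, eval_mul, eval_C, eval_pow, eval_X]
  exact hs

/-- If on a set `Z` of points of the plane each coordinate is a root of a fixed non-degenerate
quadratic (or linear) equation with real-algebraic coefficients, then `Z` is finite and its points
have algebraic coordinates. [folklore] -/
theorem cand_coords {a₀ b₀ c₀ a₁ b₁ c₁ : ℝ} {Z : Set (Fin 2 → ℝ)}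
    (hZ : ∀ n ∈ Z, a₀ * n 0 ^ 2 + b₀ * n 0 + c₀ = 0 ∧ a₁ * n 1 ^ 2 + b₁ * n 1 + c₁ = 0)
    (h₀ : a₀ ≠ 0 ∨ b₀ ≠ 0) (h₁ : a₁ ≠ 0 ∨ b₁ ≠ 0)
    (ha₀ : IsAlgebraic ℚ a₀) (hb₀ : IsAlgebraic ℚ b₀) (hc₀ : IsAlgebraic ℚ c₀)
    (ha₁ : IsAlgebraic ℚ a₁) (hb₁ : IsAlgebraic ℚ b₁) (hc₁ : IsAlgebraic ℚ c₁) :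
    Z.Finite ∧ ∀ n ∈ Z, IsAlgebraic ℚ (n 0) ∧ IsAlgebraic ℚ (n 1) :=
  ⟨(((cand_roots_finite h₀).prod (cand_roots_finite h₁)).preimage
      (finTwoArrowEquiv ℝ).injective.injOn).subset fun n hn => hZ n hn,
    fun n hn => ⟨cand_root_isAlgebraic h₀ ha₀ hb₀ hc₀ (hZ n hn).1,
      cand_root_isAlgebraic h₁ ha₁ hb₁ hc₁ (hZ n hn).2⟩⟩

/-- A genuine circle `α |n|² + A₁ n₀ + A₂ n₁ + A₃ = 0` (`α ≠ 0`) and a genuine line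
`u n₀ + v n₁ + w = 0` (`(u, v) ≠ 0`) with real-algebraic data meet in finitely many points, all with
algebraic coordinates: eliminating either coordinate gives a quadratic with leading coefficient
`α (u² + v²) ≠ 0`. [folklore] -/
theorem cand_line_circle {α A₁ A₂ A₃ u v w : ℝ} (hα : α ≠ 0) (huv : u ≠ 0 ∨ v ≠ 0)
    (hαa : IsAlgebraic ℚ α) (h₁ : IsAlgebraic ℚ A₁) (h₂ : IsAlgebraic ℚ A₂) (h₃ : IsAlgebraic ℚ A₃)
    (hu : IsAlgebraic ℚ u) (hv : IsAlgebraic ℚ v) (hw : IsAlgebraic ℚ w) {Z : Set (Fin 2 → ℝ)}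
    (hZ : ∀ n ∈ Z, α * (n 0 ^ 2 + n 1 ^ 2) + A₁ * n 0 + A₂ * n 1 + A₃ = 0 ∧
      u * n 0 + v * n 1 + w = 0) :
    Z.Finite ∧ ∀ n ∈ Z, IsAlgebraic ℚ (n 0) ∧ IsAlgebraic ℚ (n 1) := by
  have hlead : α * (u ^ 2 + v ^ 2) ≠ 0 := by rcases huv with h | h <;> positivity
  have key : ∀ n ∈ Z,
      α * (u ^ 2 + v ^ 2) * n 0 ^ 2 + (2 * α * u * w + A₁ * v ^ 2 - A₂ * u * v) * n 0
          + (α * w ^ 2 - A₂ * v * w + A₃ * v ^ 2) = 0 ∧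
        α * (u ^ 2 + v ^ 2) * n 1 ^ 2 + (2 * α * v * w + A₂ * u ^ 2 - A₁ * u * v) * n 1
          + (α * w ^ 2 - A₁ * u * w + A₃ * u ^ 2) = 0 := fun n hn =>
    ⟨by
      linear_combination v ^ 2 * (hZ n hn).1
        + (α * (u * n 0 + w - v * n 1) - A₂ * v) * (hZ n hn).2,
     by
      linear_combination u ^ 2 * (hZ n hn).1
        + (α * (v * n 1 + w - u * n 0) - A₁ * u) * (hZ n hn).2⟩
  refine cand_coords key (Or.inl hlead) (Or.inl hlead) ?_ ?_ ?_ ?_ ?_ ?_ <;>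
    apply_rules [IsAlgebraic.sub, IsAlgebraic.add, IsAlgebraic.neg, IsAlgebraic.mul, IsAlgebraic.pow,
      isAlgebraic_nat]

/-- A coefficient row `B` all of whose `2 × 2` minors with the row `A` through a pivot `A p ≠ 0`
vanish is the multiple `(B p / A p) • A` of `A`. [folklore] -/
theorem cand_eq_smul {A B : Fin 4 → ℝ} (p : Fin 4) (hp : A p ≠ 0) (h0 : A p * B 0 = B p * A 0)
    (h1 : A p * B 1 = B p * A 1) (h2 : A p * B 2 = B p * A 2) (h3 : A p * B 3 = B p * A 3) :
    B = (B p / A p) • A := by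
  funext c
  rw [Pi.smul_apply, smul_eq_mul, div_mul_eq_mul_div, eq_div_iff hp]
  obtain rfl | rfl | rfl | rfl : c = 0 ∨ c = 1 ∨ c = 2 ∨ c = 3 := by revert c; decide
  · linear_combination h0
  · linear_combination h1
  · linear_combination h2
  · linear_combination h3

/-- **Two floor traces meet in finitely many algebraic points.**  For coefficient rows `A, B`
(real-algebraic entries, neither a multiple of the other, non-zero trace parts `(· 0, · 1, · 2)`),
every set `Z` of common zeros of the traces `A 0 |n|² + A 1 n₀ + A 2 n₁ + A 3` and
`B 0 |n|² + B 1 n₀ + B 2 n₁ + B 3` is finite and consists of points with algebraic coordinates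
(radical axis / Cramer). [folklore] -/
theorem cand_pair {A B : Fin 4 → ℝ} (hAa : ∀ c, IsAlgebraic ℚ (A c)) (hBa : ∀ c, IsAlgebraic ℚ (B c))
    (hAB : ∀ μ : ℝ, A ≠ μ • B) (hBA : ∀ μ : ℝ, B ≠ μ • A)
    (hA : A 0 ≠ 0 ∨ A 1 ≠ 0 ∨ A 2 ≠ 0) (hB : B 0 ≠ 0 ∨ B 1 ≠ 0 ∨ B 2 ≠ 0) {Z : Set (Fin 2 → ℝ)}
    (hZ : ∀ n ∈ Z, A 0 * (n 0 ^ 2 + n 1 ^ 2) + A 1 * n 0 + A 2 * n 1 + A 3 = 0 ∧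
      B 0 * (n 0 ^ 2 + n 1 ^ 2) + B 1 * n 0 + B 2 * n 1 + B 3 = 0) :
    Z.Finite ∧ ∀ n ∈ Z, IsAlgebraic ℚ (n 0) ∧ IsAlgebraic ℚ (n 1) := by
  -- the affine combination `B 0 • g_A - A 0 • g_B` vanishes on `Z`
  have hlin : ∀ n ∈ Z, (B 0 * A 1 - A 0 * B 1) * n 0 + (B 0 * A 2 - A 0 * B 2) * n 1
      + (B 0 * A 3 - A 0 * B 3) = 0 := fun n hn => by
    linear_combination B 0 * (hZ n hn).1 - A 0 * (hZ n hn).2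
  have hZe : (∀ n, n ∉ Z) → Z.Finite ∧ ∀ n ∈ Z, IsAlgebraic ℚ (n 0) ∧ IsAlgebraic ℚ (n 1) :=
    fun h => ⟨Set.finite_empty.subset fun n hn => (h n hn).elim, fun n hn => (h n hn).elim⟩
  by_cases hab : B 0 * A 1 - A 0 * B 1 ≠ 0 ∨ B 0 * A 2 - A 0 * B 2 ≠ 0
  · -- a genuine line, and one of the two traces is a genuine circle
    have hla : IsAlgebraic ℚ (B 0 * A 1 - A 0 * B 1) ∧ IsAlgebraic ℚ (B 0 * A 2 - A 0 * B 2) ∧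
        IsAlgebraic ℚ (B 0 * A 3 - A 0 * B 3) := by
      refine ⟨?_, ?_, ?_⟩ <;> apply_rules [IsAlgebraic.sub, IsAlgebraic.add, IsAlgebraic.neg, IsAlgebraic.mul]
    rcases ne_or_eq (A 0) 0 with hA0 | hA0
    · exact cand_line_circle hA0 hab (hAa 0) (hAa 1) (hAa 2) (hAa 3) hla.1 hla.2.1 hla.2.2
        fun n hn => ⟨(hZ n hn).1, hlin n hn⟩
    · have hB0 : B 0 ≠ 0 := by
        rintro hB0
        rw [hA0, hB0] at hab
        exact hab.elim (fun h => h (by ring)) (fun h => h (by ring))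
      exact cand_line_circle hB0 hab (hBa 0) (hBa 1) (hBa 2) (hBa 3) hla.1 hla.2.1 hla.2.2
        fun n hn => ⟨(hZ n hn).2, hlin n hn⟩
  push Not at hab
  obtain ⟨ha, hb⟩ := hab
  rcases ne_or_eq (B 0 * A 3 - A 0 * B 3) 0 with hd | hd
  · -- the combination is a non-zero constant: no common zero
    exact hZe fun n hn => hd (by linear_combination hlin n hn - n 0 * ha - n 1 * hb)
  -- now `B 0 • A = A 0 • B`
  rcases ne_or_eq (A 0) 0 with hA0 | hA0
  · exact absurd (cand_eq_smul 0 hA0 (mul_comm _ _) (by linear_combination (-1 : ℝ) * ha)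
      (by linear_combination (-1 : ℝ) * hb) (by linear_combination (-1 : ℝ) * hd)) (hBA _)
  rcases ne_or_eq (B 0) 0 with hB0 | hB0
  · exact absurd (cand_eq_smul 0 hB0 (mul_comm _ _) (by linear_combination ha)
      (by linear_combination hb) (by linear_combination hd)) (hAB _)
  -- two lines
  have hZ' : ∀ n ∈ Z, A 1 * n 0 + A 2 * n 1 + A 3 = 0 ∧ B 1 * n 0 + B 2 * n 1 + B 3 = 0 :=
    fun n hn => by simpa [hA0, hB0] using hZ n hn
  have hA' : A 1 ≠ 0 ∨ A 2 ≠ 0 := by simpa [hA0] using hA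
  have hB' : B 1 ≠ 0 ∨ B 2 ≠ 0 := by simpa [hB0] using hB
  rcases ne_or_eq (A 1 * B 2 - A 2 * B 1) 0 with hD | hD
  · -- transversal lines: Cramer
    have key : ∀ n ∈ Z, 0 * n 0 ^ 2 + (A 1 * B 2 - A 2 * B 1) * n 0 + (A 3 * B 2 - A 2 * B 3) = 0 ∧
        0 * n 1 ^ 2 + (A 1 * B 2 - A 2 * B 1) * n 1 + (A 1 * B 3 - A 3 * B 1) = 0 := fun n hn =>
      ⟨by linear_combination B 2 * (hZ' n hn).1 - A 2 * (hZ' n hn).2,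
        by linear_combination A 1 * (hZ' n hn).2 - B 1 * (hZ' n hn).1⟩
    refine cand_coords key (Or.inr hD) (Or.inr hD) ?_ ?_ ?_ ?_ ?_ ?_ <;>
      apply_rules [IsAlgebraic.sub, IsAlgebraic.add, IsAlgebraic.neg, IsAlgebraic.mul, isAlgebraic_zero]
  -- parallel lines with a common point would have proportional rows
  refine hZe fun n hn => ?_
  obtain ⟨hAn, hBn⟩ := hZ' n hn
  rcases hB' with hB1 | hB2
  · exact hAB _ (cand_eq_smul 1 hB1 (by rw [hA0, hB0]; ring) (mul_comm _ _)
      (by linear_combination (-1 : ℝ) * hD) (by linear_combination B 1 * hAn - A 1 * hBn + n 1 * hD))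
  · exact hAB _ (cand_eq_smul 2 hB2 (by rw [hA0, hB0]; ring) (by linear_combination hD)
      (mul_comm _ _) (by linear_combination B 2 * hAn - A 2 * hBn - n 0 * hD))

/-- **Floor candidates are finite and algebraic** (stub `stub_floorCandidatesFinite`, rung 2 of the
hyperbolic scissors ladder).  For pairwise non-proportional coefficient rows `L i : Fin 4 → ℝ` with
real-algebraic entries and non-zero trace parts, the points of the boundary plane where two floor
traces `gᵢ(n) = L i 0 |n|² + L i 1 n₀ + L i 2 n₁ + L i 3` (`i ≠ j`) vanish simultaneously form a
finite set, and both coordinates of every such point are real-algebraic: two distinct generalized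
circles meet in at most two points (radical axis), with coordinates given by the quadratic formula.
[folklore] -/
theorem stub_floorCandidatesFinite :
    ∀ (k : ℕ) (L : Fin k → Fin 4 → ℝ), (∀ i c, IsAlgebraic ℚ (L i c)) →
      (∀ i j, i ≠ j → ∀ μ : ℝ, L i ≠ μ • L j) → (∀ i, L i 0 ≠ 0 ∨ L i 1 ≠ 0 ∨ L i 2 ≠ 0) →
      Set.Finite {n : Fin 2 → ℝ | ∃ i j, i ≠ j ∧
          L i 0 * (n 0 ^ 2 + n 1 ^ 2) + L i 1 * n 0 + L i 2 * n 1 + L i 3 = 0 ∧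
          L j 0 * (n 0 ^ 2 + n 1 ^ 2) + L j 1 * n 0 + L j 2 * n 1 + L j 3 = 0} ∧
      (∀ n : Fin 2 → ℝ, (∃ i j, i ≠ j ∧
          L i 0 * (n 0 ^ 2 + n 1 ^ 2) + L i 1 * n 0 + L i 2 * n 1 + L i 3 = 0 ∧
          L j 0 * (n 0 ^ 2 + n 1 ^ 2) + L j 1 * n 0 + L j 2 * n 1 + L j 3 = 0) →
          IsAlgebraic ℚ (n 0) ∧ IsAlgebraic ℚ (n 1)) := by
  intro k L halg hprop htr
  refine ⟨?_, fun n ⟨i, j, hij, hi, hj⟩ => ?_⟩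
  · have hfin : ∀ i j : Fin k, Set.Finite {n : Fin 2 → ℝ | i ≠ j ∧
        L i 0 * (n 0 ^ 2 + n 1 ^ 2) + L i 1 * n 0 + L i 2 * n 1 + L i 3 = 0 ∧
        L j 0 * (n 0 ^ 2 + n 1 ^ 2) + L j 1 * n 0 + L j 2 * n 1 + L j 3 = 0} := by
      intro i j
      by_cases hij : i = j
      · exact Set.finite_empty.subset fun n hn => (hn.1 hij).elim
      · exact (cand_pair (halg i) (halg j) (hprop i j hij) (hprop j i (Ne.symm hij)) (htr i) (htr j)
          fun n hn => hn.2).1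
    refine (Set.finite_iUnion fun i => Set.finite_iUnion fun j => hfin i j).subset ?_
    rintro n ⟨i, j, h⟩
    exact Set.mem_iUnion.2 ⟨i, Set.mem_iUnion.2 ⟨j, h⟩⟩
  · exact (cand_pair (halg i) (halg j) (hprop i j hij) (hprop j i (Ne.symm hij)) (htr i) (htr j)
      (Z := {m : Fin 2 → ℝ | L i 0 * (m 0 ^ 2 + m 1 ^ 2) + L i 1 * m 0 + L i 2 * m 1 + L i 3 = 0 ∧
        L j 0 * (m 0 ^ 2 + m 1 ^ 2) + L j 1 * m 0 + L j 2 * m 1 + L j 3 = 0})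
      fun m hm => hm).2 n ⟨hi, hj⟩

end Summit.KontsevichZagierPeriods.HyperbolicBloch.OffTetraSectorKernel
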